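import Summits.QuantumFields.YangMills.Theorems.BalabanLadderNTBoundaryLawClustering
import Summits.QuantumFields.YangMills.Theorems.LangevinControlUVOSLegsAtWeakCouplingCInheritedAmplitudeGatesDefs
import HarnessLib

/-!
# Crux `NT` (stmt-QuantumFields-19353): the sign-free conditional clustering bound on ALL femto cubes from `FBL`

Helper file (`--supports stmt-QuantumFields-19353`) of the fleet lead prover of crux `NT` (unit `ym-spine-19353-p1`,
g2); the all-cubes form of the sibling `BoundaryLaw.abs_of_fbl` (`…NTBoundaryLawClustering`, x-centred cubes).  For a
unit map with the femto boundary law `FBL G r a`: on EVERY femto cube `(c, b)` (`b · a β ≤ ℓ₁`), for every exterior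
and every pair `u, u'` with `‖u'−u‖ ≥ 16` at depth `≥ ‖u'−u‖`, `|‖u'−u‖⁸ · kerCov (dens u) (dens u')| ≤ 4 · 8⁸ · C₁²`
(`fc2IU_of_fbl`).  This is VERBATIM the unconditional hyperscaling clause (U) of the inherited two-point package `FC2I`
of the sibling crux `OSLegsAtWeakCouplingC` (stmt-QuantumFields-16207, `Theorems/…CInheritedAmplitudeGatesDefs.lean`
:135) with `κ₂ = 1`, `n₀ = 16`: the (U) half of `FC2I` needs no gates and no flat-wall comparison, only the boundary law
(`fc2I_of_fbl_of_windowedFloor`: `FC2I` from `FBL` and its windowed-floor half (L) alone).  Mechanism: conditional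
independence of two separated sub-cubes inside the cube kernel (`abs_kerCov_le_of_subcubes`).
-/

set_option autoImplicit false

noncomputable section

open MeasureTheory Filter Topology
open Literature.MathematicalPhysics.QuantumFieldTheory Literature.MathematicalPhysics.QuantumLattice
open Literature.Probability.LatticeModels
open Summit.QuantumFields.YangMills.Cruxes.OSLegsFromFemtoAndGap.DlrCollarTransfer
open Summit.QuantumFields.YangMills.Cruxes.OSLegsFromFemtoAndGap.DlrCollarTransfer.StubLower
  (exists_abs_dens_le le_depth_cube)
open Summit.QuantumFields.YangMills.Theorems.OSLegsFromFemtoAndGap.StubLower (abs_apply_le_norm)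
open Summit.QuantumFields.YangMills.Cruxes.OSLegsAtWeakCouplingC.InheritedAmplitudeGates (FC2I)

namespace Summit.QuantumFields.YangMills.Cruxes.NT.BoundaryLaw

section Clause

variable (G : Type) [Group G] [TopologicalSpace G] [IsTopologicalGroup G] [CompactSpace G]
  [MeasurableSpace G] [BorelSpace G] (r : LatticeRep G)

/-- **Clause (U) of `FC2I` from `FBL`, all cubes.**  For a unit map with the femto boundary law (witnesses
`C₁, β₁, ℓ₁`): for `β ≥ β₁`, every femto cube `(c, b)` (`b · a β ≤ ℓ₁`), every exterior `η` and every pair `u, u'` with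
`‖u'−u‖ ≥ 16` at depth `≥ ‖u'−u‖`: `|‖u'−u‖⁸ · kerCov_{(c,b),η}(dens u, dens u')| ≤ 4 · 8⁸ · C₁²`. [folklore] -/
theorem fc2IU_of_fbl (a : ℝ → ℝ) (h : FBL G r a) :
    ∃ (β₂ ℓ₂ C₂ : ℝ) (κ₂ n₀ : ℕ), 0 < ℓ₂ ∧ 1 ≤ n₀ ∧
      ∀ β : ℝ, β₂ ≤ β → ∀ (c : Fin 4 → ℤ) (b : ℕ), (b : ℝ) * a β ≤ ℓ₂ →
        ∀ (η : LGConfig 4 G) (u u' : Fin 4 → ℤ), (n₀ : ℝ) ≤ ‖siteToE (u' - u)‖ →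
          (κ₂ : ℝ) * ‖siteToE (u' - u)‖ ≤ depth c b u → (κ₂ : ℝ) * ‖siteToE (u' - u)‖ ≤ depth c b u' →
            |‖siteToE (u' - u)‖ ^ 8 * kerCov G r β c b η (dens G r u) (dens G r u')| ≤ C₂ := by
  haveI := r.secondCountableTopology
  obtain ⟨C₁, β₁, ℓ₁, p, hℓ₁, hC₁, H⟩ := h
  obtain ⟨M, -, hM⟩ := exists_abs_dens_le G r
  refine ⟨β₁, ℓ₁, 4 * 8 ^ 8 * C₁ ^ 2, 1, 16, hℓ₁, by norm_num, ?_⟩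
  intro β hβ c b hb η u u' hn hKu hKu'
  simp only [Nat.cast_one, one_mul] at hKu hKu'
  set ν : ℝ := ‖siteToE (u' - u)‖ with hν
  have hν16 : (16 : ℝ) ≤ ν := by exact_mod_cast hn
  have hν0 : 0 < ν := by linarith
  -- a long coordinate `j₀`: `ν ≤ 2 |u' j₀ − u j₀| ≤ 2 ν`
  obtain ⟨j₀, hj₀⟩ := exists_coord_ge_half_norm (u' - u)
  rw [Pi.sub_apply, Int.cast_sub] at hj₀
  have hle_ν : |((u' j₀ : ℤ) : ℝ) - u j₀| ≤ ν := by
    have := abs_apply_le_norm (siteToE (u' - u)) j₀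
    rwa [siteToE_apply, Pi.sub_apply, Int.cast_sub] at this
  -- the integer distance `m` and the radius `R₁ = ⌊(m − 3)/2⌋`
  obtain ⟨m, hm⟩ : ∃ m : ℕ, (m : ℤ) = |u' j₀ - u j₀| := ⟨(u' j₀ - u j₀).natAbs, Int.natCast_natAbs _⟩
  have hmR : (m : ℝ) = |((u' j₀ : ℤ) : ℝ) - u j₀| := by
    have := congrArg (fun z : ℤ => (z : ℝ)) hm
    simpa [Int.cast_abs, Int.cast_sub] using this
  have hm8 : 8 ≤ m := by
    have : (8 : ℝ) ≤ m := by rw [hmR]; linarith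
    exact_mod_cast this
  obtain ⟨R₁, hR₁⟩ : ∃ R₁ : ℕ, R₁ = (m - 3) / 2 := ⟨_, rfl⟩
  have hR₁1 : 1 ≤ R₁ := by omega
  have hR₁m : 2 * R₁ + 3 ≤ m := by omega
  have hmR₁ : m ≤ 2 * R₁ + 4 := by omega
  have hfar : 2 * (R₁ : ℤ) + 3 ≤ |u' j₀ - u j₀| := by rw [← hm]; exact_mod_cast hR₁m
  have hfar2 : (R₁ : ℤ) + 2 ≤ |u' j₀ - u j₀| := by
    have : (0 : ℤ) ≤ R₁ := by positivity
    linarith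
  have hνR₁ : ν / 8 ≤ (R₁ : ℝ) + 1 := by
    have h1 : (m : ℝ) ≤ 2 * R₁ + 4 := by exact_mod_cast hmR₁
    rw [hmR] at h1
    linarith
  have hR₁ν : (R₁ : ℝ) + 1 ≤ ν := by
    have h1 : (2 * R₁ + 3 : ℝ) ≤ m := by exact_mod_cast hR₁m
    rw [hmR] at h1
    linarith
  -- the sub-cubes `Q_u`, `Q_{u'}` of radius `R₁` fit in `Q`
  have hdu : R₁ + 1 ≤ depth c b u := by
    have : ((R₁ + 1 : ℕ) : ℝ) ≤ depth c b u := by push_cast; linarith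
    exact_mod_cast this
  have hdu' : R₁ + 1 ≤ depth c b u' := by
    have : ((R₁ + 1 : ℕ) : ℝ) ≤ depth c b u' := by push_cast; linarith
    exact_mod_cast this
  have hsubu : cubeEdges (fun j => u j - R₁) (2 * R₁ + 1) ⊆ cubeEdges c b :=
    cubeEdges_subset (centredCube_subset_of_le_depth hdu)
  have hsubu' : cubeEdges (fun j => u' j - R₁) (2 * R₁ + 1) ⊆ cubeEdges c b :=
    cubeEdges_subset (centredCube_subset_of_le_depth hdu')
  -- the sub-cubes are femto
  have hside : 2 * R₁ + 1 ≤ b := two_mul_add_one_le_of_le_depth hdu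
  have hb₁ : ((2 * R₁ + 1 : ℕ) : ℝ) * a β ≤ ℓ₁ := by
    rcases le_or_gt 0 (a β) with ha | ha
    · have h2 : ((2 * R₁ + 1 : ℕ) : ℝ) ≤ (b : ℝ) := by exact_mod_cast hside
      exact (mul_le_mul_of_nonneg_right h2 ha).trans hb
    · exact (mul_nonpos_iff.2 (Or.inl ⟨by positivity, ha.le⟩)).trans hℓ₁.le
  -- the boundary law in each sub-cube at its centre
  have hbl : ∀ (v : Fin 4 → ℤ) (ζ : LGConfig 4 G),
      |kerE G r β (fun j => v j - R₁) (2 * R₁ + 1) ζ (dens G r v) - p β| ≤ C₁ / ((R₁ : ℝ) + 1) ^ 4 := by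
    intro v ζ
    have hdv := le_depth_cube v v R₁ (t := 0) (fun j => by simp)
    rw [sub_zero] at hdv
    have h2v : 2 ≤ depth (fun j => v j - R₁) (2 * R₁ + 1) v := by
      have : ((2 : ℕ) : ℝ) ≤ depth (fun j => v j - R₁) (2 * R₁ + 1) v := by
        have : (2 : ℝ) ≤ (R₁ : ℝ) + 1 := by exact_mod_cast Nat.succ_le_succ hR₁1
        push_cast; linarith
      exact_mod_cast this
    refine (H β hβ _ _ hb₁ ζ v h2v).trans ?_
    exact div_le_div_of_nonneg_left hC₁ (by positivity) (pow_le_pow_left₀ (by positivity) hdv 4)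
  -- conditional independence: `|kerCov| ≤ 4 h²`, `h = C₁/(R₁+1)⁴`
  have hcyl : IsCylinder (fun ζ => kerE G r β (fun j => u j - R₁) (2 * R₁ + 1) ζ (dens G r u))
      (r.curvature.supp.image (fun e => (e.1 + u, e.2)) ∪
        (plaquettesTouching (cubeEdges (fun j => u j - R₁) (2 * R₁ + 1))).biUnion plaquetteEdges) := by
    unfold kerE
    exact dependsOn_integral_ymSpecification r.ρ r.continuous β _ (continuous_dens r u).measurable
      (StubLower.isCylinder_dens G r u)
  have hcov := abs_kerCov_le_of_subcubes G r β hsubu hsubu' η (continuous_dens r u) (continuous_dens r u')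
    (hM u) (hM u') (StubLower.isCylinder_dens G r u') (dens_supp_not_mem_cube G r hfar2) hcyl
    (condMean_supp_not_mem_cube G r hfar) (hbl u) (hbl u')
  -- arithmetic: `ν⁸ · 4 (C₁/(R₁+1)⁴)² ≤ 4 · 8⁸ C₁²` since `ν/8 ≤ R₁ + 1`
  have hh : C₁ / ((R₁ : ℝ) + 1) ^ 4 ≤ C₁ / (ν / 8) ^ 4 :=
    div_le_div_of_nonneg_left hC₁ (by positivity) (pow_le_pow_left₀ (by positivity) hνR₁ 4)
  have hh0 : 0 ≤ C₁ / ((R₁ : ℝ) + 1) ^ 4 := by positivity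
  rw [abs_mul, abs_of_nonneg (by positivity : (0 : ℝ) ≤ ν ^ 8)]
  calc ν ^ 8 * |kerCov G r β c b η (dens G r u) (dens G r u')|
      ≤ ν ^ 8 * (4 * (C₁ / ((R₁ : ℝ) + 1) ^ 4) * (C₁ / ((R₁ : ℝ) + 1) ^ 4)) :=
        mul_le_mul_of_nonneg_left hcov (by positivity)
    _ ≤ ν ^ 8 * (4 * (C₁ / (ν / 8) ^ 4) * (C₁ / (ν / 8) ^ 4)) := by gcongr
    _ = 4 * 8 ^ 8 * C₁ ^ 2 := by field_simp


/-- **`FC2I` from `FBL` and the windowed floor (L) alone.**  The inherited two-point package `FC2I G r a` of crux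
`OSLegsAtWeakCouplingC` follows from the femto boundary law and its OWN floor half (L) (stated with the threshold
`max n₀ 16` harmlessly): the hyperscaling half (U) is `fc2IU_of_fbl`. [folklore] -/
theorem fc2I_of_fbl_of_windowedFloor (a : ℝ → ℝ) (hFBL : FBL G r a)
    (hL : ∃ (ℓ₂ : ℝ) (n₀ : ℕ), 0 < ℓ₂ ∧ 1 ≤ n₀ ∧
      ∀ (Kc t : ℝ), 0 < t → ∃ (s₁ s₂ c₂ β₃ : ℝ) (κ₃ : ℕ), 0 < s₁ ∧ s₁ < s₂ ∧ s₂ ≤ t ∧ (κ₃ : ℝ) * s₂ ≤ t ∧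
        Kc * s₂ ^ 8 ≤ c₂ ∧
        ∀ β : ℝ, β₃ ≤ β → ∀ (c : Fin 4 → ℤ) (b : ℕ), (b : ℝ) * a β ≤ ℓ₂ → ∀ (η : LGConfig 4 G) (x y : Fin 4 → ℤ),
          (n₀ : ℝ) ≤ ‖siteToE (y - x)‖ →
          (κ₃ : ℝ) * ‖siteToE (y - x)‖ ≤ depth c b x → (κ₃ : ℝ) * ‖siteToE (y - x)‖ ≤ depth c b y →
          s₁ ≤ ‖siteToE (y - x)‖ * a β → ‖siteToE (y - x)‖ * a β ≤ s₂ →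
            c₂ ≤ ‖siteToE (y - x)‖ ^ 8 * kerCov G r β c b η (dens G r x) (dens G r y)) :
    FC2I G r a := by
  obtain ⟨β₂, ℓ₁, C₂, κ₂, n₁, hℓ₁, hn₁, HU⟩ := fc2IU_of_fbl G r a hFBL
  obtain ⟨ℓ₂, n₀, hℓ₂, hn₀, HL⟩ := hL
  refine ⟨β₂, min ℓ₁ ℓ₂, C₂, κ₂, max n₀ n₁, lt_min hℓ₁ hℓ₂, le_max_of_le_left hn₀, ?_, ?_⟩
  · intro β hβ c b hb η x y hn hκx hκy
    exact HU β hβ c b (hb.trans (min_le_left _ _)) η x y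
      (le_trans (by exact_mod_cast le_max_right n₀ n₁) hn) hκx hκy
  · intro Kc t ht
    obtain ⟨s₁, s₂, c₂, β₃, κ₃, hs₁, hs₁₂, hs₂t, hκ₃, hKc, H⟩ := HL Kc t ht
    refine ⟨s₁, s₂, c₂, β₃, κ₃, hs₁, hs₁₂, hs₂t, hκ₃, hKc, ?_⟩
    intro β hβ c b hb η x y hn hκx hκy h₁ h₂
    exact H β hβ c b (hb.trans (min_le_right _ _)) η x y
      (le_trans (by exact_mod_cast le_max_left n₀ n₁) hn) hκx hκy h₁ h₂

end Clause

end Summit.QuantumFields.YangMills.Cruxes.NT.BoundaryLaw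

end
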